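import Literature.NumberTheory.Automorphic.DoubledUnitaryRankOneReductionDiag
import HarnessLib

/-!
# The Borel of `U(1,1)_{E/F}`: internal factorisation `b = γ_B · n(x₃) · d(c·z(r))` and the rational Weyl flip

Topic `NumberTheory/Automorphic`; namespace `Literature.NumberTheory.Automorphic.DoubledUnitary.RankOneReduction`.
KERNEL ONLY (theorems; no definition, no named fact).  Split model `J₁ = !![0,1;1,0]` of the rank-one doubled hermitian plane
over a commutative ring `S` with an endomorphism `τ` (the adeles `𝔸_E` with `c ⊗ 1`), `U = U(τ, J₁) ≤ GL₂(S)`; its Borel `B` = the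
upper-triangular elements, with Levi `d(u) = diag(u, (τu)⁻¹)` (★ `diag_mem_unitaryGroupOfForm`), unipotent radical `n(x) = !![1,x;0,1]`
(`τ x + x = 0`), opposite radical `n⁻(x) = !![1,0;x,1]`, and the RATIONAL Weyl element `w = J₁ = !![0,1;1,0] ∈ U(F)`.
GL-elements with a prescribed unipotent ∕ Weyl matrix are introduced by EXISTENCE statements (no definition): `exists_upper`,
`exists_lower`, `exists_weyl`; all laws are stated for any GL-element with that matrix.

* §1 (any `S`, `τ`): memberships `upper_mem_iff` (`n(x) ∈ U ↔ τ x + x = 0`), `lower_mem_iff`, `weyl_mem`; the three `2 × 2` identities of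
  the Weyl flip — **`weyl_mul_glDiagonal_mul_weyl_inv`** (`w·diag(a,b)·w⁻¹ = diag(b,a)`, so `w d(τ) w⁻¹ = d((τ̄… ) = d(τ̄⁻¹)`:
  `weyl_mul_diag_mul_weyl_inv`), **`coe_weyl_mul_upper_mul_weyl_inv`** (`w n(x) w⁻¹ = n⁻(x)`), **`coe_glDiagonal_inv_mul_lower_mul_glDiagonal`**
  (`diag(a,b)⁻¹ n⁻(x) diag(a,b) = n⁻(b⁻¹ x a)`, so `d(τ)⁻¹ n⁻(x) d(τ) = n⁻(τ·τ̄·x)`) and its upper companion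
  `coe_glDiagonal_inv_mul_upper_mul_glDiagonal` (`d(τ)⁻¹ n(x) d(τ) = n(x ∕ (τ τ̄))`), `coe_upper_mul_upper` (`n(x)n(y) = n(x+y)`),
  and the Borel normal form `eq_upper_mul_diag_of_apply_one_zero` (`b = n(b₀₁·τ b₀₀) · d(b₀₀)` for upper-triangular `b ∈ U`, `τ` an involution);
* §2 (`E/F` quadratic, adeles): **`exists_borel_factorisation`** — with `C_E ⊆ 𝕀_E` compact (★ `exists_isCompact_idele_decomposition`) and
  `K_F ⊆ 𝔸_F` compact (★ `exists_isCompact_adele_decomposition`, Tate's fundamental domain): every upper-triangular `b ∈ U(𝔸_F)` is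
  `b = (d(q) · n(δξ)) · n(δω) · d(c · z_E(r))` with `q ∈ Eˣ`, `ξ ∈ F` (so `γ_B := d(q)n(δξ) ∈ B(F)`), `ω ∈ K_F`, `c ∈ C_E`, `r > 0`
  — the «RED-B» Borel-internal reduction of the Siegel–Weil boundedness step (no maximal compact subgroup, no Siegel set).

References: A. Weil, *Sur la formule de Siegel dans la théorie des groupes classiques*, Acta Math. 113 (1965), n° 50 pp. 72–74 (the
reduction to `β` in a compact set and `t` in compact × ray) and n° 47 Lemme 20; A. Weil, *Basic Number Theory* (1967) Ch. IV §4 Thm 6;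
S. Gelbart, J. Rogawski, Invent. Math. 105 (1991) §1 (`U(1,1)`, `B = MN`, `w`).

Written for the Hodge-CM cell `pub/hodgecm-mathlib`, floor 0, crux H413 (stmt-HodgeConjecture-24833), E-2 child line `F0_E2SiegelWeilWeilRange`,
SW2c-BOUND sheet v1 row (RED-B) (F0P4-plan (g4) ruling 2026-08-31T03:01:51Z; A-p16 (g18)).  HC_CM is proved only modulo the printed
citations until rung 0 closes; this file discharges none of them.
-/

noncomputable section

open NumberField IsDedekindDomain Matrix Set
open scoped MatrixGroups NNReal Pointwise

namespace Literature.NumberTheory.Automorphic.DoubledUnitary.RankOneReduction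

/-! ## §1 Generic algebra in `U(τ, J₁) ≤ GL₂(S)` -/

section Generic

variable {S : Type*} [CommRing S] (τ : S →+* S)

/-- The matrix of `glDiagonal 2 S ![a, b]` is `!![a, 0; 0, b]`. [folklore] -/
private theorem coe_glDiagonal_two'' (a b : Sˣ) :
    ((glDiagonal 2 S ![a, b] : GL (Fin 2) S) : Matrix (Fin 2) (Fin 2) S) = !![(a : S), 0; 0, (b : S)] := by
  rw [coe_glDiagonal]
  ext i j
  fin_cases i <;> fin_cases j <;> simp

/-- The matrix of `(glDiagonal 2 S ![a, b])⁻¹` is `!![a⁻¹, 0; 0, b⁻¹]`. [folklore] -/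
private theorem coe_glDiagonal_two_inv (a b : Sˣ) :
    (((glDiagonal 2 S ![a, b])⁻¹ : GL (Fin 2) S) : Matrix (Fin 2) (Fin 2) S) = !![((a⁻¹ : Sˣ) : S), 0; 0, ((b⁻¹ : Sˣ) : S)] := by
  rw [← map_inv, show (![a, b] : Fin 2 → Sˣ)⁻¹ = ![a⁻¹, b⁻¹] from funext fun i => by fin_cases i <;> rfl]
  exact coe_glDiagonal_two'' a⁻¹ b⁻¹

/-- **An upper unipotent GL-element `n(x)` with matrix `!![1, x; 0, 1]`** (and inverse `!![1, −x; 0, 1]`) exists for every `x`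
(stated as an existence: no definition is introduced). [cite: GelbartRogawski1991, §1] -/
theorem exists_upper (x : S) :
    ∃ nx : GL (Fin 2) S, (nx : Matrix (Fin 2) (Fin 2) S) = !![1, x; 0, 1] ∧ ((nx⁻¹ : GL (Fin 2) S) : Matrix (Fin 2) (Fin 2) S) = !![1, -x; 0, 1] :=
  ⟨⟨!![1, x; 0, 1], !![1, -x; 0, 1], by ext i j; fin_cases i <;> fin_cases j <;> simp [Matrix.mul_apply, Fin.sum_univ_two],
    by ext i j; fin_cases i <;> fin_cases j <;> simp [Matrix.mul_apply, Fin.sum_univ_two]⟩, rfl, rfl⟩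

/-- **A lower unipotent GL-element `n⁻(x)` with matrix `!![1, 0; x, 1]`** exists for every `x`. [cite: GelbartRogawski1991, §1] -/
theorem exists_lower (x : S) :
    ∃ mx : GL (Fin 2) S, (mx : Matrix (Fin 2) (Fin 2) S) = !![1, 0; x, 1] ∧ ((mx⁻¹ : GL (Fin 2) S) : Matrix (Fin 2) (Fin 2) S) = !![1, 0; -x, 1] :=
  ⟨⟨!![1, 0; x, 1], !![1, 0; -x, 1], by ext i j; fin_cases i <;> fin_cases j <;> simp [Matrix.mul_apply, Fin.sum_univ_two],
    by ext i j; fin_cases i <;> fin_cases j <;> simp [Matrix.mul_apply, Fin.sum_univ_two]⟩, rfl, rfl⟩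

/-- **The Weyl element `w = J₁ = !![0, 1; 1, 0]`** as a GL-element (an involution: `w⁻¹ = w`). [cite: GelbartRogawski1991, §1] -/
theorem exists_weyl :
    ∃ w : GL (Fin 2) S, (w : Matrix (Fin 2) (Fin 2) S) = !![0, 1; 1, 0] ∧ ((w⁻¹ : GL (Fin 2) S) : Matrix (Fin 2) (Fin 2) S) = !![0, 1; 1, 0] :=
  ⟨⟨!![0, 1; 1, 0], !![0, 1; 1, 0], by ext i j; fin_cases i <;> fin_cases j <;> simp [Matrix.mul_apply, Fin.sum_univ_two],
    by ext i j; fin_cases i <;> fin_cases j <;> simp [Matrix.mul_apply, Fin.sum_univ_two]⟩, rfl, rfl⟩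

/-- The inverse of a GL-element with matrix `!![0,1;1,0]` has the same matrix (`w² = 1`). [cite: GelbartRogawski1991, §1] -/
theorem coe_inv_of_coe_eq_weyl {w : GL (Fin 2) S} (hw : (w : Matrix (Fin 2) (Fin 2) S) = !![0, 1; 1, 0]) :
    ((w⁻¹ : GL (Fin 2) S) : Matrix (Fin 2) (Fin 2) S) = !![0, 1; 1, 0] :=
  Units.inv_eq_of_mul_eq_one_right (by rw [hw]; ext i j; fin_cases i <;> fin_cases j <;> simp [Matrix.mul_apply, Fin.sum_univ_two])

/-- The inverse of a GL-element with matrix `!![1,x;0,1]` has matrix `!![1,−x;0,1]` (`n(x)⁻¹ = n(−x)`). [cite: GelbartRogawski1991, §1] -/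
theorem coe_inv_of_coe_eq_upper {nx : GL (Fin 2) S} {x : S} (hn : (nx : Matrix (Fin 2) (Fin 2) S) = !![1, x; 0, 1]) :
    ((nx⁻¹ : GL (Fin 2) S) : Matrix (Fin 2) (Fin 2) S) = !![1, -x; 0, 1] :=
  Units.inv_eq_of_mul_eq_one_right (by rw [hn]; ext i j; fin_cases i <;> fin_cases j <;> simp [Matrix.mul_apply, Fin.sum_univ_two])

/-- **`w ∈ U(τ, J₁)`**: the Weyl element is unitary (its entries are `0, 1`, fixed by `τ`). [cite: GelbartRogawski1991, §1] -/
theorem weyl_mem {w : GL (Fin 2) S} (hw : (w : Matrix (Fin 2) (Fin 2) S) = !![0, 1; 1, 0]) :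
    w ∈ unitaryGroupOfForm τ (!![(0 : S), 1; 1, 0] : Matrix (Fin 2) (Fin 2) S) := by
  rw [mem_unitaryGroupOfForm_iff, hw]
  have hmap : (!![(0 : S), 1; 1, 0] : Matrix (Fin 2) (Fin 2) S).map τ = !![0, 1; 1, 0] := by
    ext i j; fin_cases i <;> fin_cases j <;> simp
  rw [hmap]
  ext i j
  fin_cases i <;> fin_cases j <;> simp [Matrix.mul_apply, Fin.sum_univ_two]

/-- **`n(x) ∈ U(τ, J₁) ↔ τ x + x = 0`** (the unipotent radical of the Borel is the trace-zero line `δ·S^τ`).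
[cite: GelbartRogawski1991, §1] -/
theorem upper_mem_iff {nx : GL (Fin 2) S} {x : S} (hn : (nx : Matrix (Fin 2) (Fin 2) S) = !![1, x; 0, 1]) :
    nx ∈ unitaryGroupOfForm τ (!![(0 : S), 1; 1, 0] : Matrix (Fin 2) (Fin 2) S) ↔ τ x + x = 0 := by
  rw [mem_unitaryGroupOfForm_iff, hn]
  have hmap : (!![(1 : S), x; 0, 1] : Matrix (Fin 2) (Fin 2) S).map τ = !![1, τ x; 0, 1] := by
    ext i j; fin_cases i <;> fin_cases j <;> simp
  rw [hmap, ← Matrix.ext_iff]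
  simp only [Fin.forall_fin_two]
  simp [Matrix.mul_apply, Fin.sum_univ_two]
  rw [add_comm]

/-- **`n⁻(x) ∈ U(τ, J₁) ↔ τ x + x = 0`.** [cite: GelbartRogawski1991, §1] -/
theorem lower_mem_iff {mx : GL (Fin 2) S} {x : S} (hm : (mx : Matrix (Fin 2) (Fin 2) S) = !![1, 0; x, 1]) :
    mx ∈ unitaryGroupOfForm τ (!![(0 : S), 1; 1, 0] : Matrix (Fin 2) (Fin 2) S) ↔ τ x + x = 0 := by
  rw [mem_unitaryGroupOfForm_iff, hm]
  have hmap : (!![(1 : S), 0; x, 1] : Matrix (Fin 2) (Fin 2) S).map τ = !![1, 0; τ x, 1] := by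
    ext i j; fin_cases i <;> fin_cases j <;> simp
  rw [hmap, ← Matrix.ext_iff]
  simp only [Fin.forall_fin_two]
  simp [Matrix.mul_apply, Fin.sum_univ_two]

/-- **The Weyl flip of the torus: `w · diag(a, b) · w⁻¹ = diag(b, a)`.** [cite: GelbartRogawski1991, §1] -/
theorem weyl_mul_glDiagonal_mul_weyl_inv {w : GL (Fin 2) S} (hw : (w : Matrix (Fin 2) (Fin 2) S) = !![0, 1; 1, 0]) (a b : Sˣ) :
    w * glDiagonal 2 S ![a, b] * w⁻¹ = glDiagonal 2 S ![b, a] := by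
  refine Units.ext ?_
  rw [Units.val_mul, Units.val_mul, coe_inv_of_coe_eq_weyl hw, hw, coe_glDiagonal_two'', coe_glDiagonal_two'']
  ext i j
  fin_cases i <;> fin_cases j <;> simp [Matrix.mul_apply, Fin.sum_univ_two]

/-- **`w · d(u) · w⁻¹ = d((τu)⁻¹)`** for the Levi element `d(u) = diag(u, (τu)⁻¹)` and an involution `τ`. [cite: GelbartRogawski1991, §1] -/
theorem weyl_mul_diag_mul_weyl_inv {w : GL (Fin 2) S} (hw : (w : Matrix (Fin 2) (Fin 2) S) = !![0, 1; 1, 0])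
    (hτ : ∀ s, τ (τ s) = s) (u : Sˣ) :
    w * glDiagonal 2 S ![u, (Units.map (τ : S →* S) u)⁻¹] * w⁻¹ =
      glDiagonal 2 S ![(Units.map (τ : S →* S) u)⁻¹, (Units.map (τ : S →* S) (Units.map (τ : S →* S) u)⁻¹)⁻¹] := by
  rw [weyl_mul_glDiagonal_mul_weyl_inv hw]
  congr 1
  funext i
  match i with
  | ⟨0, _⟩ => rfl
  | ⟨1, _⟩ =>
    show u = (Units.map (τ : S →* S) (Units.map (τ : S →* S) u)⁻¹)⁻¹
    rw [map_inv, inv_inv]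
    exact Units.ext (hτ u).symm

/-- **The Weyl flip of the unipotent radical: `w · n(x) · w⁻¹ = n⁻(x)`** (matrix form). [cite: GelbartRogawski1991, §1] -/
theorem coe_weyl_mul_upper_mul_weyl_inv {w nx : GL (Fin 2) S} {x : S} (hw : (w : Matrix (Fin 2) (Fin 2) S) = !![0, 1; 1, 0])
    (hn : (nx : Matrix (Fin 2) (Fin 2) S) = !![1, x; 0, 1]) :
    ((w * nx * w⁻¹ : GL (Fin 2) S) : Matrix (Fin 2) (Fin 2) S) = !![1, 0; x, 1] := by
  rw [Units.val_mul, Units.val_mul, coe_inv_of_coe_eq_weyl hw, hw, hn]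
  ext i j
  fin_cases i <;> fin_cases j <;> simp [Matrix.mul_apply, Fin.sum_univ_two]

/-- **`diag(a,b)⁻¹ · n⁻(x) · diag(a,b) = n⁻(b⁻¹ x a)`** (so `d(τ)⁻¹ n⁻(x) d(τ) = n⁻(τ̄ τ x)` for `d(τ) = diag(τ, τ̄⁻¹)`).
[cite: GelbartRogawski1991, §1] -/
theorem coe_glDiagonal_inv_mul_lower_mul_glDiagonal {mx : GL (Fin 2) S} {x : S} (hm : (mx : Matrix (Fin 2) (Fin 2) S) = !![1, 0; x, 1])
    (a b : Sˣ) :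
    (((glDiagonal 2 S ![a, b])⁻¹ * mx * glDiagonal 2 S ![a, b] : GL (Fin 2) S) : Matrix (Fin 2) (Fin 2) S) =
      !![1, 0; ((b⁻¹ : Sˣ) : S) * x * a, 1] := by
  rw [Units.val_mul, Units.val_mul, coe_glDiagonal_two_inv, coe_glDiagonal_two'', hm]
  ext i j
  fin_cases i <;> fin_cases j <;> simp [Matrix.mul_apply, Fin.sum_univ_two]

/-- **`diag(a,b)⁻¹ · n(x) · diag(a,b) = n(a⁻¹ x b)`** (so `d(τ)⁻¹ n(x) d(τ) = n(x ∕ (τ τ̄))`). [cite: GelbartRogawski1991, §1] -/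
theorem coe_glDiagonal_inv_mul_upper_mul_glDiagonal {nx : GL (Fin 2) S} {x : S} (hn : (nx : Matrix (Fin 2) (Fin 2) S) = !![1, x; 0, 1])
    (a b : Sˣ) :
    (((glDiagonal 2 S ![a, b])⁻¹ * nx * glDiagonal 2 S ![a, b] : GL (Fin 2) S) : Matrix (Fin 2) (Fin 2) S) =
      !![1, ((a⁻¹ : Sˣ) : S) * x * b; 0, 1] := by
  rw [Units.val_mul, Units.val_mul, coe_glDiagonal_two_inv, coe_glDiagonal_two'', hn]
  ext i j
  fin_cases i <;> fin_cases j <;> simp [Matrix.mul_apply, Fin.sum_univ_two]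

/-- **`n(x) · n(y) = n(x + y)`** (matrix form). [cite: GelbartRogawski1991, §1] -/
theorem coe_upper_mul_upper {nx ny : GL (Fin 2) S} {x y : S} (hn : (nx : Matrix (Fin 2) (Fin 2) S) = !![1, x; 0, 1])
    (hn' : (ny : Matrix (Fin 2) (Fin 2) S) = !![1, y; 0, 1]) :
    ((nx * ny : GL (Fin 2) S) : Matrix (Fin 2) (Fin 2) S) = !![1, x + y; 0, 1] := by
  rw [Units.val_mul, hn, hn']
  ext i j
  fin_cases i <;> fin_cases j <;> simp [Matrix.mul_apply, Fin.sum_univ_two, add_comm]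

/-- **`n(x) · diag(a, b)`** has matrix `!![a, x b; 0, b]` (the Borel `B = N·M`). [cite: GelbartRogawski1991, §1] -/
theorem coe_upper_mul_glDiagonal {nx : GL (Fin 2) S} {x : S} (hn : (nx : Matrix (Fin 2) (Fin 2) S) = !![1, x; 0, 1]) (a b : Sˣ) :
    ((nx * glDiagonal 2 S ![a, b] : GL (Fin 2) S) : Matrix (Fin 2) (Fin 2) S) = !![(a : S), x * b; 0, (b : S)] := by
  rw [Units.val_mul, hn, coe_glDiagonal_two'']
  ext i j
  fin_cases i <;> fin_cases j <;> simp [Matrix.mul_apply, Fin.sum_univ_two]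

/-- **Borel normal form `b = n(b₀₁ · τ b₀₀) · d(b₀₀)`**: an upper-triangular `b ∈ U(τ, J₁)` (`τ` an involution) has unit diagonal
`b₀₀ = u`, `b₁₁ = (τu)⁻¹`, and `b = n(x) · d(u)` with `x = b₀₁ · τ u`, `τ x + x = 0`. [cite: GelbartRogawski1991, §1] -/
theorem eq_upper_mul_diag_of_apply_one_zero (hτ : ∀ s, τ (τ s) = s) {b : GL (Fin 2) S}
    (hb : b ∈ unitaryGroupOfForm τ (!![(0 : S), 1; 1, 0] : Matrix (Fin 2) (Fin 2) S))
    (hb10 : (b : Matrix (Fin 2) (Fin 2) S) 1 0 = 0) :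
    ∃ u : Sˣ, (u : S) = (b : Matrix (Fin 2) (Fin 2) S) 0 0 ∧
      ∃ nx : GL (Fin 2) S, (nx : Matrix (Fin 2) (Fin 2) S) = !![1, (b : Matrix (Fin 2) (Fin 2) S) 0 1 * τ (u : S); 0, 1] ∧
        τ ((b : Matrix (Fin 2) (Fin 2) S) 0 1 * τ (u : S)) + (b : Matrix (Fin 2) (Fin 2) S) 0 1 * τ (u : S) = 0 ∧
        b = nx * glDiagonal 2 S ![u, (Units.map (τ : S →* S) u)⁻¹] := by
  set P : Matrix (Fin 2) (Fin 2) S := (b : Matrix (Fin 2) (Fin 2) S) with hP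
  have E01 := RankOneSL2.unitarity_apply hb 0 1
  have E10 := RankOneSL2.unitarity_apply hb 1 0
  have E11 := RankOneSL2.unitarity_apply hb 1 1
  simp only [← hP, Matrix.of_apply, Matrix.cons_val', Matrix.cons_val_zero, Matrix.cons_val_one,
    Matrix.cons_val_fin_one, Matrix.empty_val', hb10, map_zero, zero_mul, zero_add, mul_zero, add_zero] at E01 E10 E11
  -- `E01 : τ (P 0 0) * P 1 1 = 1`, `E10 : τ (P 1 1) * P 0 0 = 1`, `E11 : τ (P 0 1) * P 1 1 + τ (P 1 1) * P 0 1 = 0`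
  set u : Sˣ := Units.mkOfMulEqOne (P 0 0) (τ (P 1 1)) (by rw [mul_comm]; exact E10) with hu
  have hu0 : (u : S) = P 0 0 := rfl
  have hP11 : P 1 1 = (((Units.map (τ : S →* S) u)⁻¹ : Sˣ) : S) :=
    (Units.inv_eq_of_mul_eq_one_right (u := Units.map (τ : S →* S) u) E01).symm
  obtain ⟨nx, hnx, -⟩ := exists_upper (P 0 1 * τ (u : S))
  refine ⟨u, hu0, nx, hnx, ?_, ?_⟩
  · -- trace-zero: `E11 · (u · τu)` with `P 1 1 · τ u = 1 = τ(P 1 1) · u`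
    have key : (τ (P 1 1) * P 0 1 + τ (P 0 1) * P 1 1) * ((u : S) * τ (u : S)) = 0 := by rw [E11, zero_mul]
    have e1 : P 1 1 * τ (u : S) = 1 := by rw [mul_comm]; exact E01
    have e2 : τ (P 1 1) * (u : S) = 1 := E10
    calc τ (P 0 1 * τ (u : S)) + P 0 1 * τ (u : S)
        = τ (P 0 1) * (u : S) + P 0 1 * τ (u : S) := by rw [map_mul, hτ]
      _ = τ (P 0 1) * (u : S) * (P 1 1 * τ (u : S)) + P 0 1 * τ (u : S) * (τ (P 1 1) * (u : S)) := by
          rw [e1, e2, mul_one, mul_one]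
      _ = (τ (P 1 1) * P 0 1 + τ (P 0 1) * P 1 1) * ((u : S) * τ (u : S)) := by ring
      _ = 0 := key
  · refine Units.ext ?_
    rw [coe_upper_mul_glDiagonal hnx, ← hP]
    ext i j
    fin_cases i <;> fin_cases j
    · exact hu0.symm
    · show P 0 1 = P 0 1 * τ (u : S) * (((Units.map (τ : S →* S) u)⁻¹ : Sˣ) : S)
      rw [mul_assoc, show τ (u : S) = ((Units.map (τ : S →* S) u : Sˣ) : S) from rfl, Units.mul_inv, mul_one]
    · exact hb10
    · exact hP11

/-- `d` is multiplicative: `d(uv) = d(u) · d(v)` for `d(u) = diag(u, (τu)⁻¹)` (the torus is commutative). [cite: GelbartRogawski1991, §1] -/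
theorem diag_mul (u v : Sˣ) :
    glDiagonal 2 S ![u * v, (Units.map (τ : S →* S) (u * v))⁻¹] =
      glDiagonal 2 S ![u, (Units.map (τ : S →* S) u)⁻¹] * glDiagonal 2 S ![v, (Units.map (τ : S →* S) v)⁻¹] := by
  rw [← map_mul]
  congr 1
  funext i
  match i with
  | ⟨0, _⟩ => rfl
  | ⟨1, _⟩ => simp [mul_comm]

end Generic

/-! ## §2 The Borel-internal factorisation over the adeles -/

section Adelic

variable (F E : Type) [Field F] [NumberField F] [Field E] [NumberField E] [Algebra F E] (c : E ≃ₐ[F] E)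

/-- **RED-B: the Borel-internal factorisation of `B(𝔸) ≤ U(1,1)_{E/F}(𝔸_F)`.**  `E/F` quadratic with `Gal(E/F) = {1, c}`,
`δ ∈ Eˣ` with `c δ = −δ`, `δ² = d ∈ F`, `U = U(c ⊗ 1, J₁)(𝔸_F)`, `d(u) = diag(u, (c̄u)⁻¹)`, `n(x) = !![1,x;0,1]`.  There are COMPACT sets
`C_E ⊆ 𝕀_E` (★ `exists_isCompact_idele_decomposition`: `𝕀_E = Eˣ · C_E · z_E(ℝ_{>0})`) and `K_F ⊆ 𝔸_F` (★ `exists_isCompact_adele_decomposition`: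
`𝔸_F = F + K_F`) such that EVERY upper-triangular `b ∈ U` factors as
`b = d(q) · n(δξ) · n(δω) · d(c · z_E(r))` with `q ∈ Eˣ`, `ξ ∈ F` — so `γ_B := d(q) n(δξ) ∈ B(F)` — `ω ∈ K_F`, `c ∈ C_E`, `r > 0`,
the two unipotent factors in `U`.  (Weil's reduction «il suffit de faire varier `β` dans un compact et `t` dans compact × rayon» for the Borel of
the rank-one doubled unitary group; no maximal compact subgroup is involved.) [cite: Weil1965, n° 50 pp. 72–74] [cite: WeilBNT1967, Ch. IV §4 Thm 6] -/
theorem exists_borel_factorisation [IsGalois F E] (h2 : ∀ σ : E ≃ₐ[F] E, σ = 1 ∨ σ = c) (δ : Eˣ)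
    (hcδ : c (δ : E) = -(δ : E)) {d : F} (hd : (δ : E) * δ = algebraMap F E d) :
    ∃ CE : Set (AdeleRing (𝓞 E) E)ˣ, IsCompact CE ∧ ∃ KF : Set (AdeleRing (𝓞 F) F), IsCompact KF ∧
      ∀ b : GL (Fin 2) (AdeleRing (𝓞 E) E),
        b ∈ unitaryGroupOfForm (UnitaryGroup.conjAdele F E c)
            (!![(0 : AdeleRing (𝓞 E) E), 1; 1, 0] : Matrix (Fin 2) (Fin 2) (AdeleRing (𝓞 E) E)) →
        (b : Matrix (Fin 2) (Fin 2) (AdeleRing (𝓞 E) E)) 1 0 = 0 →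
        ∃ q : Eˣ, ∃ ξ : F, ∃ ω ∈ KF, ∃ cc ∈ CE, ∃ r : ℝ≥0ˣ, ∃ nξ nω : GL (Fin 2) (AdeleRing (𝓞 E) E),
          (nξ : Matrix (Fin 2) (Fin 2) (AdeleRing (𝓞 E) E)) =
              !![1, algebraMap E (AdeleRing (𝓞 E) E) ((δ : E) * algebraMap F E ξ); 0, 1] ∧
          (nω : Matrix (Fin 2) (Fin 2) (AdeleRing (𝓞 E) E)) =
              !![1, algebraMap E (AdeleRing (𝓞 E) E) (δ : E) * AdeleRing.baseChange F E ω; 0, 1] ∧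
          nξ ∈ unitaryGroupOfForm (UnitaryGroup.conjAdele F E c)
              (!![(0 : AdeleRing (𝓞 E) E), 1; 1, 0] : Matrix (Fin 2) (Fin 2) (AdeleRing (𝓞 E) E)) ∧
          nω ∈ unitaryGroupOfForm (UnitaryGroup.conjAdele F E c)
              (!![(0 : AdeleRing (𝓞 E) E), 1; 1, 0] : Matrix (Fin 2) (Fin 2) (AdeleRing (𝓞 E) E)) ∧
          b = glDiagonal 2 (AdeleRing (𝓞 E) E)
                ![Units.map (algebraMap E (AdeleRing (𝓞 E) E) : E →* AdeleRing (𝓞 E) E) q,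
                  (Units.map (UnitaryGroup.conjAdele F E c : AdeleRing (𝓞 E) E →* AdeleRing (𝓞 E) E)
                    (Units.map (algebraMap E (AdeleRing (𝓞 E) E) : E →* AdeleRing (𝓞 E) E) q))⁻¹] *
              nξ * nω *
              glDiagonal 2 (AdeleRing (𝓞 E) E)
                ![cc * posRealIdele E r,
                  (Units.map (UnitaryGroup.conjAdele F E c : AdeleRing (𝓞 E) E →* AdeleRing (𝓞 E) E) (cc * posRealIdele E r))⁻¹] := by
  classical
  set τ : AdeleRing (𝓞 E) E →+* AdeleRing (𝓞 E) E := UnitaryGroup.conjAdele F E c with hτdef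
  set ιE : E →+* AdeleRing (𝓞 E) E := algebraMap E (AdeleRing (𝓞 E) E) with hιE
  set f : AdeleRing (𝓞 F) F →+* AdeleRing (𝓞 E) E := AdeleRing.baseChange F E with hfdef
  have hττ : ∀ s, τ (τ s) = s := conjAdele_conjAdele F E c h2
  have hτf : ∀ r, τ (f r) = f r := fun r => by
    rw [hτdef, UnitaryGroup.conjAdele_apply, hfdef, AdeleRing.smul_baseChange]
  have hτι : ∀ x : E, τ (ιE x) = ιE ((c : E →+* E) x) := fun x => (UnitaryGroup.algebraMap_conj F E c x).symm
  have hτδ : τ (ιE δ) = -ιE δ := conjAdele_algebraMap_eq_neg F E c δ hcδ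
  have hfalg : ∀ x : F, f (algebraMap F (AdeleRing (𝓞 F) F) x) = ιE (algebraMap F E x) := fun x =>
    AdeleRing.baseChange_algebraMap F E x
  obtain ⟨CE, hCEc, hdecE⟩ := exists_isCompact_idele_decomposition E
  obtain ⟨KF, hKFc, hdecF⟩ := exists_isCompact_adele_decomposition F
  refine ⟨CE, hCEc, KF, hKFc, fun b hb hb10 => ?_⟩
  -- Borel normal form `b = n(x) d(u)`
  obtain ⟨u, hu0, nx, hnx, htr, hbeq⟩ := eq_upper_mul_diag_of_apply_one_zero τ hττ hb hb10
  set x : AdeleRing (𝓞 E) E := (b : Matrix (Fin 2) (Fin 2) (AdeleRing (𝓞 E) E)) 0 1 * τ (u : AdeleRing (𝓞 E) E) with hx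
  have hτx : τ x = -x := (neg_eq_of_add_eq_zero_left htr).symm
  -- idele decomposition `u = q · cc · z(r)`
  obtain ⟨q, ⟨q₀, rfl⟩, cc, hcc, r, hux⟩ := hdecE u
  set qA : (AdeleRing (𝓞 E) E)ˣ := Units.map (ιE : E →* AdeleRing (𝓞 E) E) q₀ with hqA
  set m : (AdeleRing (𝓞 E) E)ˣ := cc * posRealIdele E r with hm
  have hum : u = qA * m := by rw [hux, hm, mul_assoc]
  -- the conjugated unipotent parameter `x'' = q⁻¹ · x · (τq)⁻¹`, anti-fixed by `τ`
  set qτ : (AdeleRing (𝓞 E) E)ˣ := Units.map (τ : AdeleRing (𝓞 E) E →* AdeleRing (𝓞 E) E) qA with hqτ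
  set x'' : AdeleRing (𝓞 E) E :=
    ((qA⁻¹ : (AdeleRing (𝓞 E) E)ˣ) : AdeleRing (𝓞 E) E) * x * ((qτ⁻¹ : (AdeleRing (𝓞 E) E)ˣ) : AdeleRing (𝓞 E) E) with hx''
  have hτq₁ : τ ((qA⁻¹ : (AdeleRing (𝓞 E) E)ˣ) : AdeleRing (𝓞 E) E) = ((qτ⁻¹ : (AdeleRing (𝓞 E) E)ˣ) : AdeleRing (𝓞 E) E) := by
    rw [hqτ, Units.coe_map_inv (τ : AdeleRing (𝓞 E) E →* AdeleRing (𝓞 E) E) qA, MonoidHom.coe_coe]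
  have hτq₂ : τ ((qτ⁻¹ : (AdeleRing (𝓞 E) E)ˣ) : AdeleRing (𝓞 E) E) = ((qA⁻¹ : (AdeleRing (𝓞 E) E)ˣ) : AdeleRing (𝓞 E) E) := by
    rw [← hτq₁, hττ]
  have hτx'' : τ x'' = -x'' := by
    rw [hx'', map_mul, map_mul, hτq₁, hτq₂, hτx]
    ring
  -- descent: `x'' · δ` is `τ`-fixed, hence `= f y`
  obtain ⟨y, hy⟩ : ∃ y, f y = x'' * ιE δ :=
    exists_baseChange_eq_of_conjAdele_eq F E c h2 _ (by rw [map_mul, hτx'', hτδ, neg_mul_neg])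
  -- `𝔸_F = F + K_F` applied to `y / d`
  obtain ⟨ξ, ω, hω, hyd⟩ := hdecF (y * algebraMap F (AdeleRing (𝓞 F) F) d⁻¹)
  -- `x'' = ι(δ ξ) + ι δ · f ω`
  have hd0 : d ≠ 0 := by
    intro h
    rw [h, map_zero] at hd
    exact δ.ne_zero (mul_self_eq_zero.1 hd)
  have hδinv : ιE ((δ : E))⁻¹ = ιE δ * ιE (algebraMap F E d⁻¹) := by
    rw [← map_mul]
    congr 1
    rw [map_inv₀, ← hd, mul_inv, ← mul_assoc, mul_inv_cancel₀ δ.ne_zero, one_mul]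
  have hx''eq : x'' = ιE ((δ : E) * algebraMap F E ξ) + ιE δ * f ω := by
    have h1 : x'' = x'' * ιE δ * ιE ((δ : E))⁻¹ := by
      rw [mul_assoc, ← map_mul, mul_inv_cancel₀ δ.ne_zero, map_one, mul_one]
    rw [h1, ← hy, hδinv, map_mul ιE (δ : E), ← hfalg ξ, ← hfalg d⁻¹]
    have h2 : f y * (ιE δ * f (algebraMap F (AdeleRing (𝓞 F) F) d⁻¹)) =
        ιE δ * f (y * algebraMap F (AdeleRing (𝓞 F) F) d⁻¹) := by rw [map_mul]; ring
    rw [h2, hyd, map_add]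
    ring
  -- the two unipotent factors and their unitarity
  obtain ⟨nξ, hnξ, -⟩ := exists_upper (ιE ((δ : E) * algebraMap F E ξ))
  obtain ⟨nω, hnω, -⟩ := exists_upper (ιE δ * f ω)
  have hcδξ : (c : E →+* E) ((δ : E) * algebraMap F E ξ) = -((δ : E) * algebraMap F E ξ) := by
    show c ((δ : E) * algebraMap F E ξ) = _
    rw [map_mul, hcδ, AlgEquiv.commutes, neg_mul]
  have hnξU : nξ ∈ unitaryGroupOfForm τ (!![(0 : AdeleRing (𝓞 E) E), 1; 1, 0] : Matrix (Fin 2) (Fin 2) (AdeleRing (𝓞 E) E)) := by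
    rw [upper_mem_iff τ hnξ, hτι, hcδξ, map_neg, neg_add_cancel]
  have hnωU : nω ∈ unitaryGroupOfForm τ (!![(0 : AdeleRing (𝓞 E) E), 1; 1, 0] : Matrix (Fin 2) (Fin 2) (AdeleRing (𝓞 E) E)) := by
    rw [upper_mem_iff τ hnω, map_mul, hτδ, hτf, neg_mul, neg_add_cancel]
  -- `d(q)⁻¹ · n(x) · d(q) = n(x'') = n(δξ) · n(δω)`
  have hkey : (glDiagonal 2 (AdeleRing (𝓞 E) E) ![qA, qτ⁻¹])⁻¹ * nx * glDiagonal 2 (AdeleRing (𝓞 E) E) ![qA, qτ⁻¹] = nξ * nω := by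
    refine Units.ext ?_
    rw [coe_glDiagonal_inv_mul_upper_mul_glDiagonal hnx, coe_upper_mul_upper hnξ hnω, ← hx''eq]
  refine ⟨q₀, ξ, ω, hω, cc, hcc, r, nξ, nω, hnξ, hnω, hnξU, hnωU, ?_⟩
  calc b = nx * (glDiagonal 2 (AdeleRing (𝓞 E) E) ![qA, qτ⁻¹] * glDiagonal 2 (AdeleRing (𝓞 E) E)
        ![m, (Units.map (τ : AdeleRing (𝓞 E) E →* AdeleRing (𝓞 E) E) m)⁻¹]) := by
          rw [hbeq, hum, diag_mul τ qA m]
    _ = glDiagonal 2 (AdeleRing (𝓞 E) E) ![qA, qτ⁻¹] *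
          ((glDiagonal 2 (AdeleRing (𝓞 E) E) ![qA, qτ⁻¹])⁻¹ * nx * glDiagonal 2 (AdeleRing (𝓞 E) E) ![qA, qτ⁻¹]) *
          glDiagonal 2 (AdeleRing (𝓞 E) E) ![m, (Units.map (τ : AdeleRing (𝓞 E) E →* AdeleRing (𝓞 E) E) m)⁻¹] := by group
    _ = glDiagonal 2 (AdeleRing (𝓞 E) E) ![qA, qτ⁻¹] * nξ * nω *
          glDiagonal 2 (AdeleRing (𝓞 E) E) ![m, (Units.map (τ : AdeleRing (𝓞 E) E →* AdeleRing (𝓞 E) E) m)⁻¹] := by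
          rw [hkey, ← mul_assoc]

end Adelic

end Literature.NumberTheory.Automorphic.DoubledUnitary.RankOneReduction

end
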